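import Summits.NavierStokesRegularity.NavierStokesRegularity.Theorems.OddMorawetzLocal.Negative.OddMorawetzLocalJetAlgebra
import Literature.Analysis.Calculus.IteratedFDerivSymmetric
import Literature.Analysis.FluidPDE.VectorCalculus
import HarnessLib

/-!
# Crux `OddMorawetzLocal` (stmt-NavierStokesRegularity-1376), refutation: the divergence-free normal form is sound

Stub `nf_sound` of the refutation skeleton of the crux `OddMorawetzLocal` (lead c1); Mathlib plus two tree theorems
(the all-orders Schwarz–Clairaut theorem `Literature.Analysis.Calculus.iteratedFDeriv_comp_perm_of_contDiff` and the
trace formula `Literature.Analysis.FluidPDE.divergence_eq_sum_inner_fderiv`); no definitions, no named facts.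

The kernel computations of the refutation reduce jet polynomials modulo the differential ideal generated by the
incompressibility constraint `∂₀u₀ + ∂₁u₁ + ∂₂u₂ = 0`: the normal form `JPoly.nf` rewrites every jet variable
`∂^β ∂₂ u₂` as `-∂^β ∂₀ u₀ - ∂^β ∂₁ u₁` (`JPoly.nfVar`), multiplies out (`JPoly.subst`) and normalises (`JPoly.norm`).
This file transports that to analysis: on the actual jets `jetVal u x` of a smooth divergence-free field
`u : ℝ³ → ℝ³` the normal form of a real jet polynomial has the same value as the polynomial (`nf_sound`).

Steps (private lemmas, namespace `NfSound`): the list algebra of `JPoly.evalA` by structural inductions, whence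
`evalA (nf p) ζ = evalA p (v ↦ evalA (nfVar v) ζ)`; symmetry of `Dⁿu(x)` in its slots, whence `jetVal u x (a, l)`
depends only on the multiset `l` (`jetVal_perm`, induction on `List.Perm`, the `cons` step differentiating the
inductive identity once more via `Dⁿ⁺¹u(x)(w, M) = ∂_w (y ↦ Dⁿu(y)(M))(x)`); the differentiated constraint
`Σ_a Dⁿ⁺¹u(x)(e_a, M)_a = 0` (`sum_iteratedFDeriv_cons_stdVec`, induction on `n`, base case `div u = Σ_a ∂_a u_a`);
and the variable identity `evalA (nfVar v) (jetVal u x) = jetVal u x v` (`evalA_nfVar`, via `l ~ 2 :: dropTwo l` and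
`insertIdx i l' ~ i :: l'`).
-/

noncomputable section

set_option linter.dupNamespace false
set_option autoImplicit false

namespace Summit.NavierStokesRegularity.NavierStokesRegularity.Theorems.OddMorawetz

open Literature.Analysis.FluidPDE

namespace NfSound

/-! ### The list algebra of `evalA` -/

/-- `evalA` of a polynomial with a leading term. -/
private theorem evalA_cons (t : ℝ × List JVar) (p : JPoly ℝ) (ζ : JVar → ℝ) :
    JPoly.evalA (t :: p) ζ = t.1 * (t.2.map ζ).prod + JPoly.evalA p ζ := by
  simp [JPoly.evalA]

/-- `evalA` is additive under concatenation. -/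
private theorem evalA_append (p q : JPoly ℝ) (ζ : JVar → ℝ) :
    JPoly.evalA (p ++ q) ζ = JPoly.evalA p ζ + JPoly.evalA q ζ := by
  simp [JPoly.evalA, List.sum_append]

/-- `evalA` of a polynomial with all coefficients multiplied by `c`. -/
private theorem evalA_map_smul (c : ℝ) (q : JPoly ℝ) (ζ : JVar → ℝ) :
    JPoly.evalA (q.map fun s => (c * s.1, s.2)) ζ = c * JPoly.evalA q ζ := by
  induction q with
  | nil => simp [JPoly.evalA]
  | cons t q ih =>
      rw [List.map_cons, evalA_cons, evalA_cons, ih]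
      ring

/-- `evalA` of a polynomial multiplied by one term. -/
private theorem evalA_map_mulTerm (s : ℝ × List JVar) (q : JPoly ℝ) (ζ : JVar → ℝ) :
    JPoly.evalA (q.map fun t => (s.1 * t.1, s.2 ++ t.2)) ζ = s.1 * (s.2.map ζ).prod * JPoly.evalA q ζ := by
  induction q with
  | nil => simp [JPoly.evalA]
  | cons t q ih =>
      rw [List.map_cons, evalA_cons, evalA_cons, ih]
      simp only [List.map_append, List.prod_append]
      ring

/-- `evalA` is multiplicative on `JPoly.mul`. -/
private theorem evalA_mul (p q : JPoly ℝ) (ζ : JVar → ℝ) :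
    JPoly.evalA (JPoly.mul p q) ζ = JPoly.evalA p ζ * JPoly.evalA q ζ := by
  induction p with
  | nil => simp [JPoly.mul, JPoly.evalA]
  | cons s p ih =>
      have h : JPoly.mul (s :: p) q = (q.map fun t => (s.1 * t.1, s.2 ++ t.2)) ++ JPoly.mul p q := by
        simp [JPoly.mul]
      rw [h, evalA_append, evalA_map_mulTerm, ih, evalA_cons]
      ring

/-- `evalA` of a product of a list of polynomials. -/
private theorem evalA_prodList (ζ : JVar → ℝ) :
    ∀ ps : List (JPoly ℝ), JPoly.evalA (JPoly.prodList ps) ζ = (ps.map fun p => JPoly.evalA p ζ).prod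
  | [] => by simp [JPoly.prodList, JPoly.evalA]
  | p :: ps => by
      rw [JPoly.prodList, evalA_mul, evalA_prodList ζ ps, List.map_cons, List.prod_cons]

/-- `evalA` of a substitution is the evaluation at the values of the substituted polynomials. -/
private theorem evalA_subst (σ : JVar → JPoly ℝ) (ζ : JVar → ℝ) :
    ∀ p : JPoly ℝ, JPoly.evalA (JPoly.subst σ p) ζ = JPoly.evalA p (fun v => JPoly.evalA (σ v) ζ)
  | [] => by simp [JPoly.subst, JPoly.evalA]
  | t :: p => by
      have h : JPoly.subst σ (t :: p) =
          ((JPoly.prodList (t.2.map σ)).map fun s => (t.1 * s.1, s.2)) ++ JPoly.subst σ p := by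
        simp [JPoly.subst]
      rw [h, evalA_append, evalA_map_smul, evalA_prodList, evalA_subst σ ζ p, evalA_cons, List.map_map]
      rfl

/-- Dropping terms by a filter that only removes zero coefficients does not change `evalA`. -/
private theorem evalA_filter (P : ℝ × List JVar → Bool) (ζ : JVar → ℝ) :
    ∀ q : JPoly ℝ, (∀ t ∈ q, P t = false → t.1 = 0) → JPoly.evalA (q.filter P) ζ = JPoly.evalA q ζ
  | [], _ => rfl
  | t :: q, h => by
      have ih := evalA_filter P ζ q (fun s hs => h s (List.mem_cons_of_mem t hs))
      rw [List.filter_cons]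
      by_cases hP : P t = true
      · rw [if_pos hP, evalA_cons, evalA_cons, ih]
      · rw [if_neg hP, ih, evalA_cons, h t List.mem_cons_self (by simpa using hP)]
        ring

/-- `idxCmp` returns `eq` only on equal index lists. -/
private theorem eq_of_idxCmp : ∀ {l l' : List (Fin 3)}, idxCmp l l' = Ordering.eq → l = l'
  | [], [], _ => rfl
  | [], _ :: _, h => by simp [idxCmp] at h
  | _ :: _, [], h => by simp [idxCmp] at h
  | i :: is, j :: js, h => by
      simp only [idxCmp] at h
      split_ifs at h with h1 h2
      have hij : i = j := le_antisymm (not_lt.1 h2) (not_lt.1 h1)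
      subst hij
      rw [eq_of_idxCmp h]

/-- `JVar.cmp` returns `eq` only on equal variables. -/
private theorem eq_of_cmp {v w : JVar} (h : JVar.cmp v w = Ordering.eq) : v = w := by
  obtain ⟨a, l⟩ := v
  obtain ⟨b, l'⟩ := w
  simp only [JVar.cmp] at h
  split_ifs at h with h1 h2
  have hab : a = b := le_antisymm (not_lt.1 h2) (not_lt.1 h1)
  subst hab
  rw [eq_of_idxCmp h]

/-- `monoCmp` returns `eq` only on equal monomials. -/
private theorem eq_of_monoCmp : ∀ {m m' : List JVar}, monoCmp m m' = Ordering.eq → m = m'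
  | [], [], _ => rfl
  | [], _ :: _, h => by simp [monoCmp] at h
  | _ :: _, [], h => by simp [monoCmp] at h
  | v :: vs, w :: ws, h => by
      rw [monoCmp] at h
      cases hc : JVar.cmp v w <;> rw [hc] at h
      · simp at h
      · exact (congrArg₂ List.cons (eq_of_cmp hc) (eq_of_monoCmp h))
      · simp at h

/-- `evalA` of `insertTerm c m r` is the value of the inserted term plus `evalA r`. -/
private theorem evalA_insertTerm (c : ℝ) (m : List JVar) (ζ : JVar → ℝ) :
    ∀ r : JPoly ℝ, JPoly.evalA (JPoly.insertTerm c m r) ζ = c * (m.map ζ).prod + JPoly.evalA r ζ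
  | [] => by simp [JPoly.insertTerm, JPoly.evalA]
  | (c', m') :: rest => by
      rw [JPoly.insertTerm]
      cases hc : monoCmp m m' <;> simp only []
      · rw [evalA_cons]
      · rw [eq_of_monoCmp hc, evalA_cons, evalA_cons]
        ring
      · rw [evalA_cons, evalA_cons, evalA_insertTerm c m ζ rest]
        ring

/-- Sorted insertion of a variable permutes the monomial. -/
private theorem perm_insertVar (v : JVar) : ∀ ws : List JVar, (insertVar v ws).Perm (v :: ws)
  | [] => List.Perm.refl _
  | w :: ws => by
      rw [insertVar]
      cases hc : JVar.cmp w v <;> simp only []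
      exacts [((perm_insertVar v ws).cons w).trans (List.Perm.swap v w ws), List.Perm.refl _, List.Perm.refl _]

/-- Sorting the variables permutes the monomial. -/
private theorem perm_sortVars : ∀ m : List JVar, (sortVars m).Perm m
  | [] => List.Perm.refl _
  | v :: m => ((perm_insertVar v (sortVars m)).trans ((perm_sortVars m).cons v) :)

/-- The value of a monomial does not depend on the order of its variables. -/
private theorem prod_sortVars (m : List JVar) (ζ : JVar → ℝ) : ((sortVars m).map ζ).prod = (m.map ζ).prod :=
  ((perm_sortVars m).map ζ).prod_eq

/-- Collecting terms does not change `evalA`. -/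
private theorem evalA_collect (ζ : JVar → ℝ) :
    ∀ q : JPoly ℝ, JPoly.evalA (JPoly.collect q) ζ = JPoly.evalA q ζ
  | [] => rfl
  | t :: q => by
      show JPoly.evalA (JPoly.insertTerm t.1 (sortVars t.2) (JPoly.collect q)) ζ = _
      rw [evalA_insertTerm, prod_sortVars, evalA_collect ζ q, evalA_cons]

/-- Normalising does not change `evalA`. -/
private theorem evalA_norm (q : JPoly ℝ) (ζ : JVar → ℝ) : JPoly.evalA (JPoly.norm q) ζ = JPoly.evalA q ζ := by
  unfold JPoly.norm
  rw [evalA_filter, evalA_collect]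
  intro t _ ht
  simpa using ht

/-! ### Jets of a smooth field: symmetry and the differentiated constraint -/

/-- The argument family of `c :: l` is `e_c` followed by the family of `l`. -/
private theorem stdVec_comp_get_cons (c : Fin 3) (l : List (Fin 3)) :
    stdVec ∘ (c :: l).get = Fin.cons (stdVec c) (stdVec ∘ l.get) := by
  funext t
  exact Fin.cases rfl (fun _ => rfl) t

/-- The argument family of `c :: d :: l` is `e_c, e_d` followed by the family of `l`. -/
private theorem stdVec_comp_get_cons_cons (c d : Fin 3) (l : List (Fin 3)) :
    stdVec ∘ (c :: d :: l).get =
      (Fin.cons (stdVec c) (Fin.cons (stdVec d) (stdVec ∘ l.get)) :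
        Fin (l.length + 2) → EuclideanSpace ℝ (Fin 3)) := by
  funext t
  exact Fin.cases rfl (fun s => Fin.cases rfl (fun _ => rfl) s) t

/-- `jetVal` of a variable with a leading derivative index. -/
private theorem jetVal_cons (u : EuclideanSpace ℝ (Fin 3) → EuclideanSpace ℝ (Fin 3))
    (x : EuclideanSpace ℝ (Fin 3)) (a c : Fin 3) (l : List (Fin 3)) :
    jetVal u x (a, c :: l) = iteratedFDeriv ℝ (l.length + 1) u x (Fin.cons (stdVec c) (stdVec ∘ l.get)) a := by
  show iteratedFDeriv ℝ (l.length + 1) u x (stdVec ∘ (c :: l).get) a = _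
  rw [stdVec_comp_get_cons]

variable {u : EuclideanSpace ℝ (Fin 3) → EuclideanSpace ℝ (Fin 3)}

/-- Every iterated derivative of a smooth map is differentiable. -/
private theorem differentiableAt_iteratedFDeriv_of_contDiff (hu : ContDiff ℝ (⊤ : ℕ∞) u) (n : ℕ)
    (x : EuclideanSpace ℝ (Fin 3)) : DifferentiableAt ℝ (iteratedFDeriv ℝ n u) x :=
  (hu.differentiable_iteratedFDeriv (WithTop.coe_lt_coe.2 (ENat.coe_lt_top n))).differentiableAt

/-- Swapping the first two slots of an iterated derivative of a smooth map (Schwarz–Clairaut). -/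
private theorem iteratedFDeriv_cons_cons_swap (hu : ContDiff ℝ (⊤ : ℕ∞) u) (x : EuclideanSpace ℝ (Fin 3))
    {n : ℕ} (v w : EuclideanSpace ℝ (Fin 3)) (M : Fin n → EuclideanSpace ℝ (Fin 3)) :
    iteratedFDeriv ℝ (n + 2) u x (Fin.cons w (Fin.cons v M)) =
      iteratedFDeriv ℝ (n + 2) u x (Fin.cons v (Fin.cons w M)) := by
  have h := Literature.Analysis.Calculus.comp_swap_zero_one_eq_cons_cons
    (Fin.cons v (Fin.cons w M) : Fin (n + 2) → EuclideanSpace ℝ (Fin 3))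
  simp only [Fin.cons_zero, Fin.cons_one, Fin.tail_cons] at h
  rw [← h, Literature.Analysis.Calculus.iteratedFDeriv_comp_perm_of_contDiff hu
    (WithTop.coe_le_coe.2 le_top) x _ _]

/-- `Dⁿ⁺¹u(x)(w, M) = ∂_w (y ↦ Dⁿu(y)(M))(x)` for smooth `u`. -/
private theorem iteratedFDeriv_cons_eq_fderiv (hu : ContDiff ℝ (⊤ : ℕ∞) u) {n : ℕ}
    (w : EuclideanSpace ℝ (Fin 3)) (M : Fin n → EuclideanSpace ℝ (Fin 3)) (x : EuclideanSpace ℝ (Fin 3)) :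
    iteratedFDeriv ℝ (n + 1) u x (Fin.cons w M) = fderiv ℝ (fun y => iteratedFDeriv ℝ n u y M) x w := by
  -- adapted from `OddMorawetzOddMorawetzLocalDSound.lean`
  rw [iteratedFDeriv_succ_apply_left, Fin.cons_zero, Fin.tail_cons,
    fderiv_continuousMultilinear_apply_const_apply (differentiableAt_iteratedFDeriv_of_contDiff hu n x) M w]

/-- A coordinate of `Dⁿu(·)(M)` is differentiable, with derivative the coordinate of the derivative. -/
private theorem hasFDerivAt_iteratedFDeriv_apply_coord (hu : ContDiff ℝ (⊤ : ℕ∞) u) {n : ℕ}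
    (M : Fin n → EuclideanSpace ℝ (Fin 3)) (a : Fin 3) (x : EuclideanSpace ℝ (Fin 3)) :
    HasFDerivAt (fun y => iteratedFDeriv ℝ n u y M a)
      ((PiLp.proj 2 (fun _ : Fin 3 => ℝ) a).comp (fderiv ℝ (fun y => iteratedFDeriv ℝ n u y M) x)) x := by
  have hG : DifferentiableAt ℝ (fun y => iteratedFDeriv ℝ n u y M) x :=
    (differentiableAt_iteratedFDeriv_of_contDiff hu n x).continuousMultilinear_apply_const M
  have h := (PiLp.hasFDerivAt_apply (𝕜 := ℝ) 2 (iteratedFDeriv ℝ n u x M) a).comp x hG.hasFDerivAt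
  exact h

/-- Scalar form of `iteratedFDeriv_cons_eq_fderiv`: `Dⁿ⁺¹u(x)(w, M)_a = ∂_w (y ↦ Dⁿu(y)(M)_a)(x)`. -/
private theorem iteratedFDeriv_cons_apply_coord (hu : ContDiff ℝ (⊤ : ℕ∞) u) {n : ℕ}
    (w : EuclideanSpace ℝ (Fin 3)) (M : Fin n → EuclideanSpace ℝ (Fin 3)) (x : EuclideanSpace ℝ (Fin 3))
    (a : Fin 3) :
    iteratedFDeriv ℝ (n + 1) u x (Fin.cons w M) a = fderiv ℝ (fun y => iteratedFDeriv ℝ n u y M a) x w := by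
  rw [iteratedFDeriv_cons_eq_fderiv hu, (hasFDerivAt_iteratedFDeriv_apply_coord hu M a x).fderiv]
  rfl

/-- **Symmetry**: `jetVal u x (a, l)` depends only on the multiset of derivative indices `l`. -/
private theorem jetVal_perm (hu : ContDiff ℝ (⊤ : ℕ∞) u) {l l' : List (Fin 3)} (h : l.Perm l') :
    ∀ (x : EuclideanSpace ℝ (Fin 3)) (a : Fin 3), jetVal u x (a, l) = jetVal u x (a, l') := by
  induction h with
  | nil => intro x a; rfl
  | @cons c l₁ l₂ _ ih =>
      intro x a
      rw [jetVal_cons, jetVal_cons, iteratedFDeriv_cons_apply_coord hu, iteratedFDeriv_cons_apply_coord hu]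
      have hfun : (fun y => iteratedFDeriv ℝ l₁.length u y (stdVec ∘ l₁.get) a) =
          fun y => iteratedFDeriv ℝ l₂.length u y (stdVec ∘ l₂.get) a :=
        funext fun y => ih y a
      rw [hfun]
  | swap c d l =>
      intro x a
      show iteratedFDeriv ℝ (l.length + 2) u x (stdVec ∘ (d :: c :: l).get) a =
        iteratedFDeriv ℝ (l.length + 2) u x (stdVec ∘ (c :: d :: l).get) a
      rw [stdVec_comp_get_cons_cons, stdVec_comp_get_cons_cons, iteratedFDeriv_cons_cons_swap hu]
  | trans _ _ ih₁ ih₂ => intro x a; exact (ih₁ x a).trans (ih₂ x a)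

/-- `div v = ∂₀v₀ + ∂₁v₁ + ∂₂v₂` in the standard basis. -/
private theorem divergence_eq_three (v : EuclideanSpace ℝ (Fin 3) → EuclideanSpace ℝ (Fin 3))
    (x : EuclideanSpace ℝ (Fin 3)) :
    VectorCalculus.divergence v x =
      fderiv ℝ v x (stdVec 0) 0 + fderiv ℝ v x (stdVec 1) 1 + fderiv ℝ v x (stdVec 2) 2 := by
  rw [divergence_eq_sum_inner_fderiv (EuclideanSpace.basisFun (Fin 3) ℝ)]
  simp only [EuclideanSpace.basisFun_inner, Fin.sum_univ_three]
  simp only [EuclideanSpace.basisFun_apply]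

/-- **Differentiating the constraint**: for a smooth divergence-free field and every argument family `M`,
`Σ_a Dⁿ⁺¹u(x)(e_a, M)_a = 0` (all derivatives of `div u = 0`, one slot at a time). -/
private theorem sum_iteratedFDeriv_cons_stdVec (hu : ContDiff ℝ (⊤ : ℕ∞) u)
    (hdiv : VectorCalculus.IsDivFree u) :
    ∀ (n : ℕ) (M : Fin n → EuclideanSpace ℝ (Fin 3)) (x : EuclideanSpace ℝ (Fin 3)),
      iteratedFDeriv ℝ (n + 1) u x (Fin.cons (stdVec 0) M) 0 +
        iteratedFDeriv ℝ (n + 1) u x (Fin.cons (stdVec 1) M) 1 +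
        iteratedFDeriv ℝ (n + 1) u x (Fin.cons (stdVec 2) M) 2 = 0
  | 0, M, x => by
      have h := hdiv x
      rw [divergence_eq_three] at h
      show iteratedFDeriv ℝ 1 u x (Fin.cons (stdVec 0) M) 0 + iteratedFDeriv ℝ 1 u x (Fin.cons (stdVec 1) M) 1 +
        iteratedFDeriv ℝ 1 u x (Fin.cons (stdVec 2) M) 2 = 0
      simpa only [iteratedFDeriv_one_apply, Fin.cons_zero] using h
  | n + 1, M, x => by
      -- move `e_a` past the first slot `M 0` and differentiate the inductive identity in the direction `M 0`
      have hpeel : ∀ a : Fin 3, iteratedFDeriv ℝ (n + 2) u x (Fin.cons (stdVec a) M) a =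
          fderiv ℝ (fun y => iteratedFDeriv ℝ (n + 1) u y (Fin.cons (stdVec a) (Fin.tail M)) a) x (M 0) := by
        intro a
        conv_lhs => rw [← Fin.cons_self_tail M]
        rw [iteratedFDeriv_cons_cons_swap hu, iteratedFDeriv_cons_apply_coord hu]
      rw [hpeel 0, hpeel 1, hpeel 2]
      have hd := fun a : Fin 3 =>
        (hasFDerivAt_iteratedFDeriv_apply_coord hu (Fin.cons (stdVec a) (Fin.tail M)) a x).differentiableAt
      have hsum : HasFDerivAt
          (fun y => iteratedFDeriv ℝ (n + 1) u y (Fin.cons (stdVec 0) (Fin.tail M)) 0 +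
            iteratedFDeriv ℝ (n + 1) u y (Fin.cons (stdVec 1) (Fin.tail M)) 1 +
            iteratedFDeriv ℝ (n + 1) u y (Fin.cons (stdVec 2) (Fin.tail M)) 2)
          (fderiv ℝ (fun y => iteratedFDeriv ℝ (n + 1) u y (Fin.cons (stdVec 0) (Fin.tail M)) 0) x +
            fderiv ℝ (fun y => iteratedFDeriv ℝ (n + 1) u y (Fin.cons (stdVec 1) (Fin.tail M)) 1) x +
            fderiv ℝ (fun y => iteratedFDeriv ℝ (n + 1) u y (Fin.cons (stdVec 2) (Fin.tail M)) 2) x) x :=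
        ((hd 0).hasFDerivAt.add (hd 1).hasFDerivAt).add (hd 2).hasFDerivAt
      have hzero : (fun y => iteratedFDeriv ℝ (n + 1) u y (Fin.cons (stdVec 0) (Fin.tail M)) 0 +
            iteratedFDeriv ℝ (n + 1) u y (Fin.cons (stdVec 1) (Fin.tail M)) 1 +
            iteratedFDeriv ℝ (n + 1) u y (Fin.cons (stdVec 2) (Fin.tail M)) 2) = fun _ => (0 : ℝ) :=
        funext fun y => sum_iteratedFDeriv_cons_stdVec hu hdiv n (Fin.tail M) y
      rw [hzero] at hsum
      rw [← add_apply, ← add_apply, ← (hasFDerivAt_const (0 : ℝ) x).unique hsum]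
      simp

/-! ### The normal form of one variable -/

/-- Sorted insertion of an index permutes the index list. -/
private theorem perm_insertIdx (i : Fin 3) : ∀ l : List (Fin 3), (insertIdx i l).Perm (i :: l)
  | [] => List.Perm.refl _
  | j :: js => by
      rw [insertIdx]
      by_cases h : j < i
      · rw [if_pos h]
        exact ((perm_insertIdx i js).cons j).trans (List.Perm.swap i j js)
      · rw [if_neg h]

/-- `dropTwo` is `List.erase · 2`. -/
private theorem dropTwo_eq_erase : ∀ l : List (Fin 3), JPoly.dropTwo l = l.erase 2
  | [] => rfl
  | i :: is => by
      rw [JPoly.dropTwo, List.erase_cons, dropTwo_eq_erase is]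
      by_cases h : i = 2 <;> simp [h]

/-- An index list containing `2` is a permutation of `2 :: dropTwo`. -/
private theorem perm_cons_dropTwo {l : List (Fin 3)} (h : (2 : Fin 3) ∈ l) : l.Perm (2 :: JPoly.dropTwo l) := by
  rw [dropTwo_eq_erase]
  exact List.perm_cons_erase h

/-- **The variable identity**: on the jets of a smooth divergence-free field, `nfVar v` has the value of `v`
(`∂^β ∂₂ u₂ = -∂^β ∂₀ u₀ - ∂^β ∂₁ u₁` with `β = dropTwo l` for `v = (2, l)`, `2 ∈ l`). -/
private theorem evalA_nfVar (hu : ContDiff ℝ (⊤ : ℕ∞) u) (hdiv : VectorCalculus.IsDivFree u)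
    (x : EuclideanSpace ℝ (Fin 3)) (v : JVar) :
    JPoly.evalA (JPoly.nfVar v) (jetVal u x) = jetVal u x v := by
  obtain ⟨a, l⟩ := v
  unfold JPoly.nfVar
  split_ifs with h
  · obtain ⟨ha, hl⟩ := h
    dsimp only at ha hl
    subst ha
    dsimp only
    simp only [JPoly.evalA, List.map_cons, List.map_nil, List.sum_cons, List.sum_nil, List.prod_cons,
      List.prod_nil, mul_one, add_zero]
    rw [jetVal_perm hu (perm_insertIdx 0 _) x 0, jetVal_perm hu (perm_insertIdx 1 _) x 1,
      jetVal_perm hu (perm_cons_dropTwo hl) x 2, jetVal_cons, jetVal_cons, jetVal_cons]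
    have hsum := sum_iteratedFDeriv_cons_stdVec hu hdiv _ (stdVec ∘ (JPoly.dropTwo l).get) x
    linarith
  · simp [JPoly.evalA]

end NfSound

/-- **Soundness of the divergence-free normal form** (stub `nf_sound` of the refutation of the crux
`OddMorawetzLocal`).  For a smooth divergence-free field `u : ℝ³ → ℝ³`, a real jet polynomial `p` and a point `x`,
the normal form `JPoly.nf p` (every variable `∂^β ∂₂ u₂` rewritten as `-∂^β ∂₀ u₀ - ∂^β ∂₁ u₁`, multiplied out and
normalised) has at the jet `jetVal u x` the same value as `p`: the rewriting is the `β`-th derivative of the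
constraint `∂₀u₀ + ∂₁u₁ + ∂₂u₂ = 0`, valid by the symmetry of the mixed partials of the smooth `u`. -/
theorem nf_sound (u : EuclideanSpace ℝ (Fin 3) → EuclideanSpace ℝ (Fin 3)) (hu : ContDiff ℝ (⊤ : ℕ∞) u)
    (hdiv : Literature.Analysis.FluidPDE.VectorCalculus.IsDivFree u) (p : JPoly ℝ) (x : EuclideanSpace ℝ (Fin 3)) :
    JPoly.evalA (JPoly.nf p) (jetVal u x) = JPoly.evalA p (jetVal u x) := by
  unfold JPoly.nf
  rw [NfSound.evalA_norm, NfSound.evalA_subst]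
  have h : (fun v => JPoly.evalA (JPoly.nfVar v) (jetVal u x)) = jetVal u x :=
    funext fun v => NfSound.evalA_nfVar hu hdiv x v
  rw [h]

end Summit.NavierStokesRegularity.NavierStokesRegularity.Theorems.OddMorawetz

end
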